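import Mathlib.RepresentationTheory.Basic
import Literature.NumberTheory.EllipticCurves.TateModule
import Literature.NumberTheory.EllipticCurves.GaloisActionProofs
import Literature.NumberTheory.EllipticCurves.IwasawaDualModule
import Literature.NumberTheory.EllipticCurves.AnticyclotomicBigGaloisRep
import Literature.NumberTheory.GaloisRepresentations.GaloisCohomology
import HarnessLib

/-!
# The `p`-primary torsion `A[p^∞]` of a discrete Galois module as a continuous `ℤ_p`-linear
# representation; `E[p^∞] = T_pE ⊗ ℚ_p/ℤ_p` and the big representation `M_f = T_pE ⊗_{ℤ_p} Λ^*`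

Cell `bsd-stepL` (crux `stmt-BirchSwinnertonDyer-19270`, Road FF). The big anticyclotomic
representation landed as `AnticyclotomicBigGaloisRep κ ρ` (co-induced model on a DISCRETE
`𝒪`-module `A = T ⊗_𝒪 Frac(𝒪)/𝒪` with `ρ : ContinuousRep Γ_K 𝒪 A`), with the instance
"`A = E[p^∞] ⊗ 𝒪` … coefficient plumbing from the tree's Weierstrass layer" left as a TODO. This file
does that plumbing for `𝒪 = ℤ_p` (the ring of the kernel glue, `IwasawaAlgebra p = ℤ_p⟦T⟧`):
DEFINITIONS WITH BODIES and proved lemmas, no named fact, no `sorry`; instances only on the new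
carrier `PrimaryTorsion A p`.

## Source

* J.-P. Serre, *Abelian ℓ-adic representations and elliptic curves* (1968), Ch. I §1.2 (the
  `ℓ`-adic representation `T_ℓ`, `V_ℓ`, `V_ℓ/T_ℓ = E_{ℓ^∞}`: "the `ℤ_ℓ`-module … `E_{ℓ^∞} = ⋃ E_{ℓⁿ}` on
  which `G` acts continuously"); J. H. Silverman, *AEC* (2009), III.§7 ("`E[m]` is a `ℤ/mℤ`-module
  … the Tate module … `G_{K̄/K}` acts on `T_ℓ(E)` … continuously").
* F. Castella, Camb. J. Math. 6 (2018), §2.1 (p. 4): "`T = T_p(E)` the `p`-adic Tate module …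
  `H¹(K_w, V/T) ≃ H¹(K_w, E[p^∞])`", "`𝒜 := T ⊗_{ℤ_p} Λ^*`"; C. Skinner, E. Urban, Invent. Math. 195
  (2014), Prop. 3.2.3 (Shapiro: `H¹(F_∞, T ⊗_A A^*) = H¹(F, T ⊗_A Λ^*_{F,A}(ε_F⁻¹))`, `T ⊗ A^* = V/T`).

## What is defined (namespace `Literature.NumberTheory.EllipticCurves`)

* **`PrimaryTorsion A p = A[p^∞]`**, a type synonym of Mathlib's `AddCommGroup.primaryComponent A p`
  (`{a | ∃ k, p^k • a = 0}`) for ANY additive commutative group `A`, with its canonical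
  **`ℤ_p`-module structure** `c • a := (c mod p^k) • a` for any `p^k` killing `a` (the tree's
  `IwasawaDual.zpT`, independent of `k` by `IwasawaDual.zpT_of_le`) — `E[p^∞]` "as a `ℤ_p`-module"
  — the discrete topology, and the action of any monoid `G` acting distributively on `A`
  (the tree's `primaryComponent.instDistribMulAction`), which commutes with the `ℤ_p`-scalars.
* **`primaryTorsionRep hA : ContinuousRep G ℤ_[p] (PrimaryTorsion A p)`** for a topological group
  `G` acting on `A` with OPEN point stabilisers (`hA`): the `ℤ_p`-linear representation
  (Mathlib `Representation.ofDistribMulAction`) with its joint continuity for the discrete topology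
  PROVED (`ContinuousRep.ofStabilizerMemNhdsOne`).
* **`WeierstrassCurve.primaryTorsionGaloisRep W p : GaloisRep F ℤ_[p] (PrimaryTorsion (geomPoints W) p)`**
  — `E[p^∞] = E(F̄)[p^∞]` of a Weierstrass curve over any field `F` as a continuous `ℤ_p`-linear
  representation of `Γ_F` (open stabilisers: the tree's DISCHARGED
  `WeierstrassCurve.isOpen_stabilizer_point_holds`). Its carrier is the tree's
  `W.geomPrimaryTorsion p` (same subgroup of `geomPoints W`).
* **`WeierstrassCurve.anticyclotomicBigRep W p κ`** — the instance (i) of the definition item: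
  `M_f = T_pE ⊗_{ℤ_p} Λ^*(Ψ⁻¹) = C^∞(ℤ_p, E[p^∞])` over the `ℤ_p`-extension `κ` of the base field
  `K` of `W` (`AnticyclotomicBigGaloisRep κ (W.primaryTorsionGaloisRep p)`), a
  `ContinuousRep Γ_K ℤ_p⟦T⟧ (BigRepModule ℤ_[p] p (PrimaryTorsion (geomPoints W) p))` — the input
  `ρf` (over `Λ = IwasawaAlgebra p`) of the kernel glue
  `Summit.….XAc.map_charIdeal_le_span_of_roadFF_unr_le`, and, with `BigGaloisRep.selmerBig`, the
  module whose Selmer dual Shapiro's lemma compares with `Castella2018.AcSelmer.XAc`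
  ([SkinnerUrban2014, Prop. 3.2.3] — a separate fact, not asserted here).

References: [Serre1968] Ch. I §1.2; [SilvermanAEC2009] III.§7; [Castella2018] §2.1;
[SkinnerUrban2014] §3.1.3, Prop. 3.2.3; [Lang1990] Ch. 5 §1 (the `ℤ_p`-action through `ℤ/p^k`).
-/

noncomputable section

open Field Topology
open Literature.NumberTheory.GaloisRepresentations

universe u v

namespace Literature.NumberTheory.EllipticCurves

/-! ### §1. `A[p^∞]` as a discrete `ℤ_p`-module -/

/-- **`A[p^∞]`**, the `p`-primary torsion `{a ∈ A | ∃ k, p^k • a = 0}` of an additive commutative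
group (Mathlib's `AddCommGroup.primaryComponent A p`), as a type synonym carrying the canonical
`ℤ_p`-module structure and the discrete topology ("`E_{ℓ^∞} = ⋃ₙ E_{ℓⁿ}`", a `ℤ_ℓ`-module).
[cite: Serre1968, Ch. I §1.2 (`E_{ℓ^∞}`, `V_ℓ/T_ℓ`)] -/
def PrimaryTorsion (A : Type u) [AddCommGroup A] (p : ℕ) : Type u :=
  ↥(AddCommGroup.primaryComponent A p)

namespace PrimaryTorsion

variable {A : Type u} [AddCommGroup A] {p : ℕ}

/-- `A[p^∞]` is an abelian group (instance plumbing on the new carrier). [folklore] -/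
instance instAddCommGroup : AddCommGroup (PrimaryTorsion A p) :=
  inferInstanceAs (AddCommGroup ↥(AddCommGroup.primaryComponent A p))

/-- `A[p^∞]` carries the discrete topology. [folklore] -/
instance instTopologicalSpace : TopologicalSpace (PrimaryTorsion A p) := ⊥

/-- `A[p^∞]` is discrete. [folklore] -/
instance instDiscreteTopology : DiscreteTopology (PrimaryTorsion A p) := ⟨rfl⟩

/-- The underlying element of `A`. [folklore] -/
@[coe] def val (a : PrimaryTorsion A p) : A := a.1

/-- Coercion `A[p^∞] → A`. [folklore] -/
instance instCoeOut : CoeOut (PrimaryTorsion A p) A := ⟨val⟩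

/-- Two elements of `A[p^∞]` are equal iff their images in `A` are (`E_{ℓ^∞} ⊂ E(K̄)`). [cite: Serre1968, Ch. I §1.2 (`E_{ℓ^∞} = ⋃ E_{ℓⁿ}` inside `E(K̄)`)] -/
@[ext] theorem ext {a b : PrimaryTorsion A p} (h : (a : A) = b) : a = b := Subtype.ext h

/-- The element of `A[p^∞]` given by `a ∈ A` with `p^k • a = 0`. [cite: Serre1968, Ch. I §1.2 (`E_{ℓ^∞} = ⋃ E_{ℓⁿ}`)] -/
def mk (a : A) (k : ℕ) (h : p ^ k • a = 0) : PrimaryTorsion A p := ⟨a, ⟨k, h⟩⟩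

/-- Unfolding `mk`. [cite: Serre1968, Ch. I §1.2 (`E_{ℓ^∞} = ⋃ E_{ℓⁿ}`)] -/
@[simp] theorem val_mk (a : A) (k : ℕ) (h : p ^ k • a = 0) : ((mk a k h : PrimaryTorsion A p) : A) = a :=
  rfl

/-- Coercion of `0` (`E_{ℓ^∞}` is a subgroup). [cite: Serre1968, Ch. I §1.2] -/
@[simp] theorem val_zero : ((0 : PrimaryTorsion A p) : A) = 0 := rfl

/-- Coercion of a sum (`E_{ℓ^∞}` is a subgroup). [cite: Serre1968, Ch. I §1.2] -/
@[simp] theorem val_add (a b : PrimaryTorsion A p) : ((a + b : PrimaryTorsion A p) : A) = a + b := rfl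

/-- Coercion of natural multiples (`E_{ℓ^∞}` is a subgroup). [cite: Serre1968, Ch. I §1.2] -/
@[simp] theorem val_nsmul (n : ℕ) (a : PrimaryTorsion A p) :
    ((n • a : PrimaryTorsion A p) : A) = n • (a : A) := rfl

/-- Every element of `A[p^∞]` is killed by some `p^k`. [cite: Serre1968, Ch. I §1.2 (`E_{ℓ^∞} = ⋃ₙ E_{ℓⁿ}`)] -/
theorem exists_pow_smul_eq_zero (a : PrimaryTorsion A p) : ∃ k : ℕ, p ^ k • (a : A) = 0 := a.2

/-- A chosen exponent `k(a)` with `p^{k(a)} • a = 0`. [folklore] -/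
def level (a : PrimaryTorsion A p) : ℕ := Classical.choose a.2

/-- `p^{k(a)} • a = 0`. [cite: Serre1968, Ch. I §1.2 (`E_{ℓ^∞} = ⋃ₙ E_{ℓⁿ}`)] -/
theorem level_spec (a : PrimaryTorsion A p) : p ^ a.level • (a : A) = 0 := Classical.choose_spec a.2

variable [Fact p.Prime]

/-- **The `ℤ_p`-scalar multiplication on `A[p^∞]`**: `c • a := (c mod p^{k(a)}) • a` (the tree's
`IwasawaDual.zpT`; independent of the chosen exponent, `val_smul_eq_zpT`).
[cite: Lang1990, Ch. 5 §1 (the action of `ℤ_p = lim ℤ/p^k` on `p`-power torsion)] -/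
instance instSMul : SMul ℤ_[p] (PrimaryTorsion A p) :=
  ⟨fun c a => ⟨IwasawaDual.zpT p a.level c (a : A), ⟨a.level, IwasawaDual.zpT_torsion a.level_spec c⟩⟩⟩

/-- Unfolding the `ℤ_p`-action at the chosen exponent. [cite: Lang1990, Ch. 5 §1] -/
theorem val_smul (c : ℤ_[p]) (a : PrimaryTorsion A p) :
    ((c • a : PrimaryTorsion A p) : A) = IwasawaDual.zpT p a.level c (a : A) :=
  rfl

/-- **Independence of the exponent**: `c • a = (c mod p^k) • a` for ANY `k` with `p^k • a = 0`.
[cite: Lang1990, Ch. 5 §1] -/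
theorem val_smul_eq_zpT (c : ℤ_[p]) (a : PrimaryTorsion A p) {k : ℕ} (hk : p ^ k • (a : A) = 0) :
    ((c • a : PrimaryTorsion A p) : A) = IwasawaDual.zpT p k c (a : A) := by
  rw [val_smul]
  rcases le_total a.level k with h | h
  · rw [IwasawaDual.zpT_of_le h a.level_spec]
  · rw [IwasawaDual.zpT_of_le h hk]

/-- **`A[p^∞]` is a `ℤ_p`-module** ("`E_{ℓ^∞}` … a `ℤ_ℓ`-module"): all axioms reduce to the tree's
`zpT` lemmas on an element killed by a common `p^k`. [cite: Serre1968, Ch. I §1.2] [cite: Lang1990, Ch. 5 §1] -/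
instance instModule : Module ℤ_[p] (PrimaryTorsion A p) where
  one_smul a := ext (by rw [val_smul, IwasawaDual.zpT_one a.level_spec])
  mul_smul c d a := ext (by
    rw [val_smul, IwasawaDual.zpT_mul a.level_spec,
      val_smul_eq_zpT c (d • a) (IwasawaDual.zpT_torsion a.level_spec d), val_smul])
  smul_zero c := ext (by rw [val_smul, val_zero, IwasawaDual.zpT_zero_right])
  smul_add c a b := ext (by
    have ha : p ^ (a.level + b.level) • (a : A) = 0 := by
      rw [pow_add, mul_comm, mul_smul, a.level_spec, smul_zero]
    have hb : p ^ (a.level + b.level) • (b : A) = 0 := by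
      rw [pow_add, mul_smul, b.level_spec, smul_zero]
    have hab : p ^ (a.level + b.level) • ((a + b : PrimaryTorsion A p) : A) = 0 := by
      rw [val_add, smul_add, ha, hb, add_zero]
    rw [val_smul_eq_zpT c _ hab, val_add, val_add, IwasawaDual.zpT_add_right,
      val_smul_eq_zpT c a ha, val_smul_eq_zpT c b hb])
  add_smul c d a := ext (by
    rw [val_add, val_smul, val_smul, val_smul, IwasawaDual.zpT_add_left a.level_spec])
  zero_smul a := ext (by rw [val_smul, val_zero, IwasawaDual.zpT_zero_left])

/-- Natural-number scalars embedded in `ℤ_p` act as natural multiples: `(n : ℤ_p) • a = n • a`.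
[cite: Lang1990, Ch. 5 §1] -/
theorem natCast_smul (n : ℕ) (a : PrimaryTorsion A p) : ((n : ℤ_[p]) • a) = n • a := by
  apply ext
  rw [val_smul, val_nsmul, IwasawaDual.zpT_def, map_natCast, ZMod.val_natCast,
    IwasawaDual.mod_smul_eq a.level_spec]

/-- `p^k ∈ ℤ_p` kills an element killed by `p^k`: the `ℤ_p`-module `A[p^∞]` is `p`-primary torsion.
[cite: Serre1968, Ch. I §1.2 (`E_{ℓ^∞} = ⋃ E_{ℓⁿ}`)] -/
theorem pow_smul_eq_zero_of (a : PrimaryTorsion A p) {k : ℕ} (hk : p ^ k • (a : A) = 0) :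
    ((p : ℤ_[p]) ^ k) • a = 0 := by
  apply ext
  rw [← Nat.cast_pow, natCast_smul, val_nsmul, hk, val_zero]

/-! #### The action of a monoid `G` acting on `A` -/

section Action

variable {G : Type v} [Monoid G] [DistribMulAction G A]

/-- The induced action of `G` on `A[p^∞]` (the tree's `primaryComponent.instDistribMulAction`:
`G` preserves `p`-power torsion). [cite: Serre1968, Ch. I §1.2 ("on which `G` acts")] -/
instance instDistribMulAction : DistribMulAction G (PrimaryTorsion A p) :=
  inferInstanceAs (DistribMulAction G ↥(AddCommGroup.primaryComponent A p))

omit [Fact p.Prime] in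
/-- Unfolding the action: `(g • a : A) = g • (a : A)`. [cite: Serre1968, Ch. I §1.2] -/
@[simp] theorem val_gsmul (g : G) (a : PrimaryTorsion A p) :
    ((g • a : PrimaryTorsion A p) : A) = g • (a : A) :=
  rfl

/-- The `G`-action on `A[p^∞]` is `ℤ_p`-linear (it commutes with natural multiples).
[cite: Serre1968, Ch. I §1.2 (the `ℤ_ℓ[G]`-module `E_{ℓ^∞}`)] -/
instance instSMulCommClass : SMulCommClass G ℤ_[p] (PrimaryTorsion A p) :=
  ⟨fun g c a => ext (by
    have hga : p ^ a.level • ((g • a : PrimaryTorsion A p) : A) = 0 := by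
      rw [val_gsmul, smul_comm, a.level_spec, smul_zero]
    rw [val_gsmul, val_smul, val_smul_eq_zpT c (g • a) hga, val_gsmul, IwasawaDual.zpT_def,
      IwasawaDual.zpT_def, smul_comm])⟩

/-- **The `ℤ_p`-linear representation of `G` on `A[p^∞]`** (Mathlib `Representation.ofDistribMulAction`).
[cite: Serre1968, Ch. I §1.2] -/
def representation (p : ℕ) [Fact p.Prime] (G : Type v) [Monoid G] (A : Type u) [AddCommGroup A]
    [DistribMulAction G A] : Representation ℤ_[p] G (PrimaryTorsion A p) :=
  Representation.ofDistribMulAction ℤ_[p] G (PrimaryTorsion A p)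

/-- Unfolding the representation: `ρ g a = g • a`. [cite: Serre1968, Ch. I §1.2] -/
@[simp] theorem representation_apply (g : G) (a : PrimaryTorsion A p) :
    representation p G A g a = g • a :=
  rfl

end Action

end PrimaryTorsion

/-! ### §2. Continuity: `A[p^∞]` as a `ContinuousRep G ℤ_p` for open point stabilisers -/

section Continuous

variable {A : Type u} [AddCommGroup A] {p : ℕ} [Fact p.Prime]
variable {G : Type v} [Group G] [TopologicalSpace G] [ContinuousMul G]

/-- **`A[p^∞]` as a continuous `ℤ_p`-linear representation of a topological group `G`** acting on
`A` distributively with OPEN point stabilisers (`A` a discrete `G`-module): the representation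
`PrimaryTorsion.representation` with joint continuity for the discrete topology PROVED
(`ContinuousRep.ofStabilizerMemNhdsOne`: the stabiliser of `a ∈ A[p^∞]` is that of `a ∈ A`).
[cite: Serre1968, Ch. I §1.2 ("`E_{ℓ^∞}` … on which `G` acts continuously")]
[cite: SerreGaloisCohomology1997, II.§1 (discrete Galois modules: open stabilisers)] -/
def primaryTorsionRep [DistribMulAction G A]
    (hA : ∀ a : A, IsOpen ((MulAction.stabilizer G a : Subgroup G) : Set G)) :
    ContinuousRep G ℤ_[p] (PrimaryTorsion A p) :=
  ContinuousRep.ofStabilizerMemNhdsOne (PrimaryTorsion.representation p G A) fun a =>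
    Filter.mem_of_superset ((hA (a : A)).mem_nhds (by simp)) fun g hg =>
      PrimaryTorsion.ext (by simpa using hg)

/-- Unfolding `primaryTorsionRep`: `ρ g a = g • a`. [cite: Serre1968, Ch. I §1.2] -/
@[simp] theorem primaryTorsionRep_apply [DistribMulAction G A]
    (hA : ∀ a : A, IsOpen ((MulAction.stabilizer G a : Subgroup G) : Set G)) (g : G)
    (a : PrimaryTorsion A p) : primaryTorsionRep hA g a = g • a :=
  rfl

end Continuous

end Literature.NumberTheory.EllipticCurves

/-! ### §3. `E[p^∞]` of a Weierstrass curve and the big representation `M_f = T_pE ⊗ Λ^*` -/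

namespace WeierstrassCurve

open Literature.NumberTheory.EllipticCurves

variable {F : Type u} [Field F] (W : WeierstrassCurve F) (p : ℕ) [Fact p.Prime]

/-- **`E[p^∞] = E(F̄)[p^∞]` as a continuous `ℤ_p`-linear representation of `Γ_F`**
(`GaloisRep F ℤ_[p]`, carrier `PrimaryTorsion (geomPoints W) p` = the tree's `W.geomPrimaryTorsion p`
with its `ℤ_p`-module structure): the Galois action on geometric points restricted to `p`-power
torsion, continuous for the discrete topology by the tree's DISCHARGED open-stabiliser theorem
`WeierstrassCurve.isOpen_stabilizer_point_holds`. This is `V/T = T_pE ⊗ ℚ_p/ℤ_p` of [Cas18, §2.1].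
[cite: Serre1968, Ch. I §1.2] [cite: SilvermanAEC2009, III.§7 (the Tate module; `G_{K̄/K}` acts continuously)]
[cite: Castella2018, §2.1 (p. 4, "`H¹(K_w, V/T) ≃ H¹(K_w, E[p^∞])`")] -/
def primaryTorsionGaloisRep : GaloisRep F ℤ_[p] (PrimaryTorsion (geomPoints W) p) :=
  primaryTorsionRep (isOpen_stabilizer_point_holds W)

/-- Unfolding `primaryTorsionGaloisRep`: `σ` acts on `P ∈ E[p^∞]` as on the point `P ∈ E(F̄)`.
[cite: SilvermanAEC2009, III.§7] -/
@[simp] theorem primaryTorsionGaloisRep_apply (σ : absoluteGaloisGroup F)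
    (P : PrimaryTorsion (geomPoints W) p) : W.primaryTorsionGaloisRep p σ P = σ • P :=
  rfl

/-- On underlying points: `(σ · P : E(F̄)) = σ • (P : E(F̄))`. [cite: SilvermanAEC2009, III.§7] -/
theorem val_primaryTorsionGaloisRep_apply (σ : absoluteGaloisGroup F)
    (P : PrimaryTorsion (geomPoints W) p) :
    ((W.primaryTorsionGaloisRep p σ P : PrimaryTorsion (geomPoints W) p) : geomPoints W) =
      σ • (P : geomPoints W) :=
  rfl

/-- **`M_f = T_pE ⊗_{ℤ_p} Λ^*(Ψ⁻¹)`** for a Weierstrass curve `W` over a field `K` and a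
`ℤ_p`-extension `κ` of `K` (intended: `K` imaginary quadratic, `κ` anticyclotomic): the instance
`A = E[p^∞]`, `𝒪 = ℤ_p` of the tree's `AnticyclotomicBigGaloisRep` (co-induced model: smooth
`E[p^∞]`-valued functions on `ℤ_p`, `Γ_K` acting by `ρ_{E,p} ⊗ Ψ⁻¹`, `Λ = ℤ_p⟦T⟧` through
`1 + T ↦ γ`) — "`𝒜 := T ⊗_{ℤ_p} Λ^*` … the `G_K`-action on `𝒜` is given by `ρ_{E,p} ⊗ Ψ⁻¹`". The
input `ρf` over `Λ = IwasawaAlgebra p` of the kernel's Road-FF glue.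
[cite: Castella2018, §2.1 (p. 4, "`𝒜 := T ⊗_{ℤ_p} Λ^*`", "`ρ_{E,p} ⊗ Ψ⁻¹`")]
[cite: SkinnerUrban2014, Prop. 3.2.3 (the co-induced model)] -/
abbrev anticyclotomicBigRep [TopologicalSpace (PowerSeries ℤ_[p])] (κ : ZpExtension F p) :
    ContinuousRep (absoluteGaloisGroup F) (PowerSeries ℤ_[p])
      (BigRepModule ℤ_[p] p (PrimaryTorsion (geomPoints W) p)) :=
  AnticyclotomicBigGaloisRep κ (W.primaryTorsionGaloisRep p)

/-- A topological generator `γ` of the `ℤ_p`-extension (`κ γ = 1`) acts on `M_f` by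
`(γ · Φ)(x) = γ • Φ(x - 1)` (so that `T = γ - 1` on `Λ`, "`1 + T ↦ γ`").
[cite: Castella2018, §2.2 (p. 5, "`1 + T ↦ γ`")] -/
theorem anticyclotomicBigRep_apply_of_isTopGenerator [TopologicalSpace (PowerSeries ℤ_[p])]
    (κ : ZpExtension F p) {γ : absoluteGaloisGroup F} (hγ : κ.IsTopGenerator γ)
    (Φ : BigRepModule ℤ_[p] p (PrimaryTorsion (geomPoints W) p)) (x : ℤ_[p]) :
    W.anticyclotomicBigRep p κ γ Φ x = γ • Φ (x - 1) :=
  AnticyclotomicBigGaloisRep_apply_of_isTopGenerator κ (W.primaryTorsionGaloisRep p) hγ Φ x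

end WeierstrassCurve

end
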